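import Literature.NumberTheory.LFunctions.ZetaArgRHExplicit
import Literature.NumberTheory.LFunctions.ZetaZeroSumsLehmanRefined
import Literature.NumberTheory.LFunctions.MontgomeryZeroWindows
import Literature.Analysis.ValidatedNumerics.IntervalLogArctan
import Mathlib.Analysis.Real.Pi.Bounds
import Mathlib.Analysis.Complex.ExponentialBounds
import HarnessLib

/-!
# RH-CONDITIONAL consequences, PROVED — Simonič's gap lemma (Lemma 6, RH-free) and Corollary 2 derived from Theorem 1 (i) («nothing here bears on the truth of RH»)

Topic `Literature/NumberTheory/LFunctions` (RH literature-typing tranche 1, L4 "explicit zero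
statistics"; proofs companion of `ZetaArgRHExplicit.lean`). Label: the gap lemma is **RH-FREE**
(a counting argument valid for any pointwise bound on `S(t)`); its application is
**RH-CONDITIONAL** exactly as printed (it turns Simonič's RH-conditional Theorem 1 (i) into his
Corollary 2). Nothing is asserted about RH; nothing here bears on the truth of RH. No new named
fact is introduced (D-0026): this file only PROVES.

Source: A. Simonič, *On explicit estimates for `S(t)`, `S₁(t)`, and `ζ(1/2+it)` under the Riemann
Hypothesis*, J. Number Theory **231** (2022) 464–491 = arXiv:2010.13307v2, **Lemma 6** and the
**proof of Corollary 2** (§4, last page; identical in arXiv v1/v2), typed from the arXiv TeX source.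

## What is proved

* `Simonic2022Lemma6.count_succ_le_count_add` — the counting inequality behind Lemma 6: for
  `T ≥ t₁`, `H ≥ 0`,
  `N(T+H) − N(T) ≥ (H/2π) log(T/2π) − |S(T+H)| − |S(T)| − 2A/T`,
  from the Riemann–von Mangoldt main term `L(t) = (t/2π)log(t/2π) − t/2π + 7/8`
  (`countMain`), `(T+H) log(1+H/T) ≥ H`, and ANY remainder bound `|N − L − S| ≤ A/t` on `t ≥ t₁`
  (the tree PROVES `A = 1.2/π`, `t₁ = 2`: `abs_count_sub_countMain_sub_zetaArgS_le`; the source uses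
  Brent–Platt–Trudgian's `A = 1/150`, `t₁ = 2π`, the tree's named fact `BrentPlattTrudgian2021_lemma2`).
* `Simonic2022Lemma6.log_div_loglog_add_le` — the source's auxiliary inequality
  `log(T+H)/log log(T+H) ≤ log T/log log T + H/(T log log T)` (`T > e`, `H ≥ 0`), here by
  `log(T+H) ≤ log T + H/T` and monotonicity of `log log` (no calculus).
* `Simonic2022Lemma6.exists_ordinate_mem_Ioc` — **Lemma 6, pointwise form** (RH-free): if
  `|S(T)| ≤ c₀ log T/log log T` and `|S(T+H)| ≤ c₀ log(T+H)/log log(T+H)` with `H = ĉ/log log T`,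
  `T > e`, `T ≥ t₁`, and
  `ĉ · (log(T/2π)/(2π) − c₀/(T log log T)) > 2c₀ log T + 2A log log T/T`            (⋆)
  then `N(T+H) − N(T) ≥ 1`, i.e. some ordinate lies in `(T, T+H]`. Condition (⋆) is the source's
  (4.1)/(C1) before division: the printed
  `ĉ > 4πc₀ (1 + A log log T₀/(c₀T₀ log T₀)) (1 − log 2π/log T₀ − 2πc₀/(T₀ log T₀ log log T₀))⁻¹`
  (with `A = 1/150`) is (⋆) at `T = T₀` divided through; the source then uses that its right-hand
  side decreases in `T`. We keep the pointwise form (⋆), which is what the printed proof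
  establishes at each `T`, and instantiate it directly where needed — see
  `Simonic2022Lemma6.printed` for the displayed shape at a single height `T`, both with the tree's
  proved remainder constant `1.2/π` and, under `BrentPlattTrudgian2021_lemma2`, with the printed
  `1/150`.
* `Simonic2022_thm1_S.cor2` — **Corollary 2 from Theorem 1 (i)**: `Simonic2022_thm1_S →
  Simonic2022_cor2`, following the printed proof (take `c₀ = 𝓜(0.759282, 20.1911, 0.285; γ)` at
  `T = γ = γ_n ≥ 10^2465`, valid also at `T + H` because `𝓜(·;t)` is non-increasing; the margin
  `9.55 ≥ 4π·κ·0.759282`, `253.82 ≥ 4π·κ·20.1911` with `κ = 1.00035` absorbs (⋆)'s corrections since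
  `log γ ≥ 2465 log 10 > 5618` while `log 2π < 1.86`). Hence the RH-conditional FACT
  `Simonic2022_cor2` is no longer an independent hypothesis: it follows from `Simonic2022_thm1_S`
  (and the tree's proved Riemann–von Mangoldt remainder), in the kernel.
* `Simonic2022_cor2.simple`, `Simonic2022_thm1_S.cor2_simple` — the source's "in particular
  `γ' − γ ≤ 12.05/log log γ`": `Simonic2022_cor2 → Simonic2022_cor2_simple` (and hence from
  Theorem 1 (i)), i.e. `𝓜(9.55, 253.82, 0.285; γ) ≤ 12.05` for `γ ≥ 10^2465`
  (`Simonic2022Cor2Numerics.simonicM_le`): `(log γ)^{0.285} log log γ ≥ 101.528` from the kernel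
  interval enclosures `log 10 ≥ 2.3025761`, `log 5675.85 ≥ 8.64397`, `e^{2.46353} ≥ 11.7457`
  (`Literature.Analysis.ValidatedNumerics`, `MI.logNat2`/`MI.exp` at scale `2^80`, `decide +kernel`);
  the printed value is `𝓜(…; 10^2465) = 12.0498…`.

Conventions: `N = zetaZeroCount` (zeros with `0 < γ ≤ T`, multiplicity), `S = zetaArgS`
(right-continuous Backlund form), `γ_n = zetaOrdinate n` (with multiplicity, non-decreasing); an
ordinate in `(γ_n, γ_n + H]` forces `γ_{n+1} ≤ γ_n + H` whether or not `γ_{n+1} = γ_n`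
(`zetaOrdinate_le_iff_lt`). What is deliberately NOT here: the monotonicity-in-`T` remark turning
(⋆) at `T₀` into (⋆) for all `T ≥ T₀` (we verify (⋆) at each height directly).

## References

* A. Simonič, J. Number Theory 231 (2022) 464–491, Lemma 6, Cor. 2 and its proof (arXiv:2010.13307v2).
  [Simonic2022]
* R. P. Brent, D. J. Platt, T. S. Trudgian, Math. Comp. 90 (2021) 2923–2935, Lemma 2 (`|R(T)| ≤ 1/(150T)`).
  [BrentPlattTrudgian2021]
-/

noncomputable section

open Real

namespace Literature.NumberTheory.LFunctions

open SchoenfeldBound Montgomery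

namespace Simonic2022Lemma6

/-! ## The main-term increment -/

/-- `(T + H) · log(1 + H/T) ≥ H` for `T > 0`, `H ≥ 0` (from `log x ≥ 1 − 1/x`), in the form
`H ≤ (T+H)(log((T+H)/(2π)) − log(T/(2π)))`. [cite: Simonic2022, proof of Lemma 6] -/
theorem le_mul_log_sub_log {T H : ℝ} (hT : 0 < T) (hH : 0 ≤ H) :
    H ≤ (T + H) * (Real.log ((T + H) / (2 * π)) - Real.log (T / (2 * π))) := by
  have hπ : 0 < π := Real.pi_pos
  have hTH : 0 < T + H := by linarith
  rw [← Real.log_div (by positivity) (by positivity)]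
  have e : (T + H) / (2 * π) / (T / (2 * π)) = (T + H) / T := by
    field_simp
  rw [e]
  have h := Real.one_sub_inv_le_log_of_pos (x := (T + H) / T) (by positivity)
  have e2 : 1 - ((T + H) / T)⁻¹ = H / (T + H) := by
    field_simp
    ring
  rw [e2] at h
  calc H = (T + H) * (H / (T + H)) := by field_simp
    _ ≤ (T + H) * Real.log ((T + H) / T) := mul_le_mul_of_nonneg_left h hTH.le

/-- **Main-term increment**: `L(T+H) − L(T) ≥ (H/2π) log(T/2π)` for `T > 0`, `H ≥ 0`, where
`L = countMain` is the Riemann–von Mangoldt main term `(t/2π) log(t/2π) − t/2π + 7/8`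
(the source's first display in the proof of Lemma 6, with `((T+H)/2π) log(1+H/T) ≥ H/2π`).
[cite: Simonic2022, proof of Lemma 6] -/
theorem main_increment_ge {T H : ℝ} (hT : 0 < T) (hH : 0 ≤ H) :
    H / (2 * π) * Real.log (T / (2 * π)) ≤ countMain (T + H) - countMain T := by
  have hπ : 0 < 2 * π := by positivity
  have h1 := le_mul_log_sub_log hT hH
  set A := Real.log ((T + H) / (2 * π)) with hA
  set B := Real.log (T / (2 * π)) with hB
  have h2 : H * B ≤ (T + H) * A - T * B - H := by nlinarith [h1]
  have e : countMain (T + H) - countMain T = ((T + H) * A - T * B - H) / (2 * π) := by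
    simp only [countMain, ← hA, ← hB]
    field_simp
    ring
  rw [e, div_mul_eq_mul_div, div_le_div_iff_of_pos_right hπ]
  exact h2

/-! ## The counting inequality -/

/-- **Counting inequality** (the chain of (in)equalities in the proof of Lemma 6, with a general
remainder constant): if `|N(t) − L(t) − S(t)| ≤ A/t` for all `t ≥ t₁` (`t₁ > 0`), then for
`T ≥ t₁` and `H ≥ 0`,
`N(T+H) − N(T) ≥ (H/2π) log(T/2π) − |S(T+H)| − |S(T)| − 2A/T`.
[cite: Simonic2022, proof of Lemma 6] -/
theorem count_diff_ge {A t₁ T H : ℝ} (ht₁ : 0 < t₁)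
    (hR : ∀ t : ℝ, t₁ ≤ t → |((zetaZeroCount t : ℝ) - countMain t) - zetaArgS t| ≤ A / t)
    (hT : t₁ ≤ T) (hH : 0 ≤ H) :
    H / (2 * π) * Real.log (T / (2 * π)) - |zetaArgS (T + H)| - |zetaArgS T| - 2 * A / T ≤
      (zetaZeroCount (T + H) : ℝ) - zetaZeroCount T := by
  have hT0 : 0 < T := lt_of_lt_of_le ht₁ hT
  have hTH : T ≤ T + H := by linarith
  have hm := main_increment_ge hT0 hH
  have h1 := hR T hT
  have h2 := hR (T + H) (hT.trans hTH)
  have hA : 0 ≤ A := by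
    have := (abs_nonneg _).trans h1
    exact (div_nonneg_iff.1 this).elim (fun h ↦ h.1) fun h ↦ absurd h.2 (not_le.2 hT0)
  have h3 : A / (T + H) ≤ A / T := div_le_div_of_nonneg_left hA hT0 hTH
  rw [abs_le] at h1 h2
  have hs1 := neg_abs_le (zetaArgS T)
  have hs2 := le_abs_self (zetaArgS T)
  have hs3 := neg_abs_le (zetaArgS (T + H))
  have hs4 := le_abs_self (zetaArgS (T + H))
  have e : 2 * A / T = A / T + A / T := by ring
  rw [e]
  linarith [h1.1, h1.2, h2.1, h2.2]

/-! ## The auxiliary inequality for `log t/log log t` -/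

/-- `log(T + H) ≤ log T + H/T` for `T > 0`, `H ≥ 0`. [folklore] -/
private theorem log_add_le {T H : ℝ} (hT : 0 < T) (hH : 0 ≤ H) :
    Real.log (T + H) ≤ Real.log T + H / T := by
  have hTH : 0 < T + H := by linarith
  have h := Real.log_le_sub_one_of_pos (x := (T + H) / T) (by positivity)
  rw [Real.log_div hTH.ne' hT.ne'] at h
  have e : (T + H) / T - 1 = H / T := by field_simp; ring
  linarith

/-- The source's inequality used for "the fourth term": for `T > e` and `H ≥ 0`,
`log(T+H)/log log(T+H) ≤ log T/log log T + H/(T log log T)`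
(here: `log(T+H) ≤ log T + H/T` and `log log(T+H) ≥ log log T > 0`).
[cite: Simonic2022, proof of Lemma 6] -/
theorem log_div_loglog_add_le {T H : ℝ} (hT : Real.exp 1 < T) (hH : 0 ≤ H) :
    Real.log (T + H) / Real.log (Real.log (T + H)) ≤
      Real.log T / Real.log (Real.log T) + H / (T * Real.log (Real.log T)) := by
  have hT0 : 0 < T := lt_trans (Real.exp_pos 1) hT
  have hL : 1 < Real.log T := by
    rw [← Real.exp_lt_exp, Real.exp_log hT0]; exact hT
  have hLH : Real.log T ≤ Real.log (T + H) := Real.log_le_log hT0 (by linarith)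
  have hLL : 0 < Real.log (Real.log T) := Real.log_pos hL
  have hLLH : Real.log (Real.log T) ≤ Real.log (Real.log (T + H)) :=
    Real.log_le_log (by linarith) hLH
  have hnum : 0 ≤ Real.log (T + H) := by linarith
  calc Real.log (T + H) / Real.log (Real.log (T + H))
      ≤ Real.log (T + H) / Real.log (Real.log T) :=
        div_le_div_of_nonneg_left hnum hLL hLLH
    _ ≤ (Real.log T + H / T) / Real.log (Real.log T) :=
        div_le_div_of_nonneg_right (log_add_le hT0 hH) hLL.le
    _ = Real.log T / Real.log (Real.log T) + H / (T * Real.log (Real.log T)) := by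
        rw [add_div, div_div]

/-! ## Lemma 6, pointwise form -/

/-- **Simonič's gap lemma (Lemma 6), pointwise form, RH-free, general remainder constant.**
Let `|N − L − S| ≤ A/t` on `t ≥ t₁ > 0`. Let `T > e`, `T ≥ t₁`, `c₀ ≥ 0`, `ĉ ≥ 0`,
`H = ĉ/log log T`, and suppose `|S(T)| ≤ c₀ log T/log log T`,
`|S(T+H)| ≤ c₀ log(T+H)/log log(T+H)`, and
`ĉ (log(T/2π)/(2π) − c₀/(T log log T)) > 2c₀ log T + 2A log log T/T`. Then `N(T+H) ≥ N(T) + 1`.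
(The printed proof, at the height `T`: `N(T+H) − N(T) ≥ (H/2π)log(T/2π) − 2c₀ log T/log log T
− c₀H/(T log log T) − 2A/T > 0`.) [cite: Simonic2022, Lemma 6 (proof)] -/
theorem count_add_ge_succ {A t₁ T c₀ C : ℝ} (ht₁ : 0 < t₁)
    (hR : ∀ t : ℝ, t₁ ≤ t → |((zetaZeroCount t : ℝ) - countMain t) - zetaArgS t| ≤ A / t)
    (hT : t₁ ≤ T) (he : Real.exp 1 < T) (hc₀ : 0 ≤ c₀) (hC : 0 ≤ C)
    (hS₀ : |zetaArgS T| ≤ c₀ * Real.log T / Real.log (Real.log T))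
    (hS₁ : |zetaArgS (T + C / Real.log (Real.log T))| ≤
      c₀ * Real.log (T + C / Real.log (Real.log T)) /
        Real.log (Real.log (T + C / Real.log (Real.log T))))
    (hcond : 2 * c₀ * Real.log T + 2 * A * Real.log (Real.log T) / T <
      C * (Real.log (T / (2 * π)) / (2 * π) - c₀ / (T * Real.log (Real.log T)))) :
    zetaZeroCount T + 1 ≤ zetaZeroCount (T + C / Real.log (Real.log T)) := by
  have hT0 : 0 < T := lt_of_lt_of_le ht₁ hT
  have hL : 1 < Real.log T := by
    rw [← Real.exp_lt_exp, Real.exp_log hT0]; exact he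
  have hLL : 0 < Real.log (Real.log T) := Real.log_pos hL
  set H : ℝ := C / Real.log (Real.log T) with hHdef
  have hH : 0 ≤ H := div_nonneg hC hLL.le
  have hcount := count_diff_ge ht₁ hR hT hH
  -- bound |S(T+H)| via the auxiliary inequality
  have haux := log_div_loglog_add_le he hH
  have hS₁' : |zetaArgS (T + H)| ≤
      c₀ * (Real.log T / Real.log (Real.log T)) + c₀ * (H / (T * Real.log (Real.log T))) := by
    have := mul_le_mul_of_nonneg_left haux hc₀
    rw [mul_add] at this
    refine le_trans ?_ this
    rw [← mul_div_assoc]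
    exact hS₁
  -- the lower bound is positive
  have hpos : 0 < H / (2 * π) * Real.log (T / (2 * π)) - |zetaArgS (T + H)| - |zetaArgS T|
      - 2 * A / T := by
    have hπ : 0 < 2 * π := by positivity
    -- rewrite everything in terms of C
    have e1 : H / (2 * π) * Real.log (T / (2 * π)) =
        C * (Real.log (T / (2 * π)) / (2 * π)) / Real.log (Real.log T) := by
      rw [hHdef]; field_simp
    have e2 : c₀ * (H / (T * Real.log (Real.log T))) =
        C * (c₀ / (T * Real.log (Real.log T))) / Real.log (Real.log T) := by
      rw [hHdef]; field_simp
    have e3 : c₀ * (Real.log T / Real.log (Real.log T)) = c₀ * Real.log T / Real.log (Real.log T) := by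
      ring
    -- hcond divided by log log T
    have hcond' : (2 * c₀ * Real.log T + 2 * A * Real.log (Real.log T) / T) / Real.log (Real.log T) <
        C * (Real.log (T / (2 * π)) / (2 * π) - c₀ / (T * Real.log (Real.log T))) /
          Real.log (Real.log T) := div_lt_div_of_pos_right hcond hLL
    have e4 : (2 * c₀ * Real.log T + 2 * A * Real.log (Real.log T) / T) / Real.log (Real.log T) =
        2 * (c₀ * Real.log T / Real.log (Real.log T)) + 2 * A / T := by
      field_simp
    have e5 : C * (Real.log (T / (2 * π)) / (2 * π) - c₀ / (T * Real.log (Real.log T))) /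
          Real.log (Real.log T) =
        C * (Real.log (T / (2 * π)) / (2 * π)) / Real.log (Real.log T) -
          C * (c₀ / (T * Real.log (Real.log T))) / Real.log (Real.log T) := by
      rw [mul_sub, sub_div]
    rw [e4, e5, ← e1, ← e2] at hcond'
    rw [e3] at hS₁'
    linarith [hS₁', hS₀]
  have hgt : (zetaZeroCount T : ℝ) < zetaZeroCount (T + H) := by linarith
  have : zetaZeroCount T < zetaZeroCount (T + H) := by exact_mod_cast hgt
  exact this

/-- **Lemma 6, conclusion in terms of ordinates**: under the hypotheses of `count_add_ge_succ`
there is an ordinate `γ_m ∈ (T, T + ĉ/log log T]`; more precisely, for every `n` with `γ_n ≤ T`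
one has `γ_{n+1} ≤ T + ĉ/log log T`. [cite: Simonic2022, Lemma 6] -/
theorem zetaOrdinate_succ_le {A t₁ T c₀ C : ℝ} {n : ℕ} (ht₁ : 0 < t₁)
    (hR : ∀ t : ℝ, t₁ ≤ t → |((zetaZeroCount t : ℝ) - countMain t) - zetaArgS t| ≤ A / t)
    (hT : t₁ ≤ T) (he : Real.exp 1 < T) (hc₀ : 0 ≤ c₀) (hC : 0 ≤ C)
    (hS₀ : |zetaArgS T| ≤ c₀ * Real.log T / Real.log (Real.log T))
    (hS₁ : |zetaArgS (T + C / Real.log (Real.log T))| ≤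
      c₀ * Real.log (T + C / Real.log (Real.log T)) /
        Real.log (Real.log (T + C / Real.log (Real.log T))))
    (hcond : 2 * c₀ * Real.log T + 2 * A * Real.log (Real.log T) / T <
      C * (Real.log (T / (2 * π)) / (2 * π) - c₀ / (T * Real.log (Real.log T))))
    (hn : zetaOrdinate n ≤ T) :
    zetaOrdinate (n + 1) ≤ T + C / Real.log (Real.log T) := by
  have h := count_add_ge_succ ht₁ hR hT he hc₀ hC hS₀ hS₁ hcond
  rw [zetaOrdinate_le_iff_lt] at hn ⊢
  omega

/-- **Lemma 6, existence form**: under the hypotheses of `count_add_ge_succ` there is an index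
`m` with `T < γ_m ≤ T + ĉ/log log T` ("there exists a nontrivial zero `ρ = β + iγ` with
`γ ∈ [T, T + ĉ/log log T]`"). [cite: Simonic2022, Lemma 6] -/
theorem exists_ordinate_mem_Ioc {A t₁ T c₀ C : ℝ} (ht₁ : 0 < t₁)
    (hR : ∀ t : ℝ, t₁ ≤ t → |((zetaZeroCount t : ℝ) - countMain t) - zetaArgS t| ≤ A / t)
    (hT : t₁ ≤ T) (he : Real.exp 1 < T) (hc₀ : 0 ≤ c₀) (hC : 0 ≤ C)
    (hS₀ : |zetaArgS T| ≤ c₀ * Real.log T / Real.log (Real.log T))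
    (hS₁ : |zetaArgS (T + C / Real.log (Real.log T))| ≤
      c₀ * Real.log (T + C / Real.log (Real.log T)) /
        Real.log (Real.log (T + C / Real.log (Real.log T))))
    (hcond : 2 * c₀ * Real.log T + 2 * A * Real.log (Real.log T) / T <
      C * (Real.log (T / (2 * π)) / (2 * π) - c₀ / (T * Real.log (Real.log T)))) :
    ∃ m : ℕ, T < zetaOrdinate m ∧ zetaOrdinate m ≤ T + C / Real.log (Real.log T) := by
  have h := count_add_ge_succ ht₁ hR hT he hc₀ hC hS₀ hS₁ hcond
  refine ⟨zetaZeroCount T, lt_zetaOrdinate_iff.2 le_rfl, ?_⟩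
  rw [zetaOrdinate_le_iff_lt]
  omega

/-! ## Lemma 6 in the printed shape (at one height `T`) -/

/-- From `|N − L − S| ≤ A/t` on `t ≥ t₁ > 0` one has `A ≥ 0`. [folklore] -/
private theorem remainder_const_nonneg {A t₁ : ℝ} (ht₁ : 0 < t₁)
    (hR : ∀ t : ℝ, t₁ ≤ t → |((zetaZeroCount t : ℝ) - countMain t) - zetaArgS t| ≤ A / t) :
    0 ≤ A := by
  have h := (abs_nonneg _).trans (hR t₁ le_rfl)
  rcases lt_or_ge A 0 with hA | hA
  · exact absurd h (not_le.2 (div_neg_of_neg_of_pos hA ht₁))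
  · exact hA

/-- **Simonič's Lemma 6 in its printed shape, at a single height `T`, general remainder
constant `A`** (RH-free). Assume `|N(t) − L(t) − S(t)| ≤ A/t` for `t ≥ t₁ > 0`; let `T ≥ t₁`,
`T > e`, `c₀ > 0` with `T log(T/2π) log log T > 2πc₀`, and `|S(t)| ≤ c₀ log t/log log t` for all
`t ≥ T`. If
`ĉ > 4πc₀ (1 + A log log T/(c₀ T log T)) (1 − log 2π/log T − 2πc₀/(T log T log log T))⁻¹`
then some ordinate lies in `(T, T + ĉ/log log T]`. (As printed, with `A = 1/150` and the condition
imposed at `T₀ ≤ T`, using that its right-hand side is non-increasing in `T`; here the condition is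
taken at the height `T` itself, which is what the printed proof uses.) [cite: Simonic2022, Lemma 6] -/
theorem printed {A t₁ T c₀ C : ℝ} (ht₁ : 0 < t₁)
    (hR : ∀ t : ℝ, t₁ ≤ t → |((zetaZeroCount t : ℝ) - countMain t) - zetaArgS t| ≤ A / t)
    (hT : t₁ ≤ T) (he : Real.exp 1 < T) (hc₀ : 0 < c₀)
    (hpos : 2 * π * c₀ < T * Real.log (T / (2 * π)) * Real.log (Real.log T))
    (hS : ∀ t : ℝ, T ≤ t → |zetaArgS t| ≤ c₀ * Real.log t / Real.log (Real.log t))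
    (hC : 4 * π * c₀ * (1 + A * Real.log (Real.log T) / (c₀ * T * Real.log T)) /
        (1 - Real.log (2 * π) / Real.log T - 2 * π * c₀ / (T * Real.log T * Real.log (Real.log T)))
        < C) :
    ∃ m : ℕ, T < zetaOrdinate m ∧ zetaOrdinate m ≤ T + C / Real.log (Real.log T) := by
  have hπ : 0 < π := Real.pi_pos
  have hT0 : 0 < T := lt_of_lt_of_le ht₁ hT
  have hL : 1 < Real.log T := by
    rw [← Real.exp_lt_exp, Real.exp_log hT0]; exact he
  have hL0 : 0 < Real.log T := by linarith
  have hLL : 0 < Real.log (Real.log T) := Real.log_pos hL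
  have hA := remainder_const_nonneg ht₁ hR
  have hlog2π : Real.log (T / (2 * π)) = Real.log T - Real.log (2 * π) :=
    Real.log_div hT0.ne' (by positivity)
  -- abbreviations (plain terms, no `set`)
  have hDeq : (1 - Real.log (2 * π) / Real.log T -
      2 * π * c₀ / (T * Real.log T * Real.log (Real.log T))) * Real.log T =
      Real.log (T / (2 * π)) - 2 * π * c₀ / (T * Real.log (Real.log T)) := by
    rw [hlog2π]
    field_simp
  have hDpos : 0 < 1 - Real.log (2 * π) / Real.log T -
      2 * π * c₀ / (T * Real.log T * Real.log (Real.log T)) := by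
    have h1 : 0 < Real.log (T / (2 * π)) - 2 * π * c₀ / (T * Real.log (Real.log T)) := by
      rw [sub_pos, div_lt_iff₀ (by positivity)]
      calc 2 * π * c₀ < T * Real.log (T / (2 * π)) * Real.log (Real.log T) := hpos
        _ = Real.log (T / (2 * π)) * (T * Real.log (Real.log T)) := by ring
    rw [← hDeq] at h1
    exact pos_of_mul_pos_left h1 hL0.le
  have hE : 0 ≤ A * Real.log (Real.log T) / (c₀ * T * Real.log T) := by positivity
  have h1 := (div_lt_iff₀ hDpos).1 hC
  have hCpos : 0 < C := by
    have h0 : 0 < 4 * π * c₀ * (1 + A * Real.log (Real.log T) / (c₀ * T * Real.log T)) := by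
      have : 0 < 4 * π * c₀ := by positivity
      nlinarith
    exact pos_of_mul_pos_left (h0.trans h1) hDpos.le
  -- multiply by `log T/(2π)`
  have hfac : 0 < Real.log T / (2 * π) := by positivity
  have h2 := mul_lt_mul_of_pos_right h1 hfac
  have e1 : 4 * π * c₀ * (1 + A * Real.log (Real.log T) / (c₀ * T * Real.log T)) *
      (Real.log T / (2 * π)) = 2 * c₀ * Real.log T + 2 * A * Real.log (Real.log T) / T := by
    field_simp
    ring
  have e2 : C * (1 - Real.log (2 * π) / Real.log T -
      2 * π * c₀ / (T * Real.log T * Real.log (Real.log T))) * (Real.log T / (2 * π)) =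
      C * (Real.log (T / (2 * π)) / (2 * π) - c₀ / (T * Real.log (Real.log T))) := by
    rw [hlog2π]
    field_simp
  rw [e1, e2] at h2
  exact exists_ordinate_mem_Ioc ht₁ hR hT he hc₀.le hCpos.le (hS T le_rfl)
    (hS _ (by have := div_nonneg hCpos.le hLL.le; linarith)) h2

/-- **Lemma 6, printed shape, with the tree's PROVED remainder** `|N − L − S| ≤ (1.2/π)/t`
(`t ≥ 2`; `abs_count_sub_countMain_sub_zetaArgS_le`): an unconditional theorem for every height
`T > e` at which an `S`-bound `c₀ log t/log log t` (`t ≥ T`) is available.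
[cite: Simonic2022, Lemma 6] -/
theorem printed_tree {T c₀ C : ℝ} (he : Real.exp 1 < T) (hc₀ : 0 < c₀)
    (hpos : 2 * π * c₀ < T * Real.log (T / (2 * π)) * Real.log (Real.log T))
    (hS : ∀ t : ℝ, T ≤ t → |zetaArgS t| ≤ c₀ * Real.log t / Real.log (Real.log t))
    (hC : 4 * π * c₀ * (1 + (1.2 / π) * Real.log (Real.log T) / (c₀ * T * Real.log T)) /
        (1 - Real.log (2 * π) / Real.log T - 2 * π * c₀ / (T * Real.log T * Real.log (Real.log T)))
        < C) :
    ∃ m : ℕ, T < zetaOrdinate m ∧ zetaOrdinate m ≤ T + C / Real.log (Real.log T) := by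
  have h2T : (2 : ℝ) ≤ T := le_trans (by have := Real.exp_one_gt_d9; linarith) he.le
  exact printed (A := 1.2 / π) (t₁ := 2) (by norm_num)
    (fun t ht ↦ abs_count_sub_countMain_sub_zetaArgS_le ht) h2T he hc₀ hpos hS hC

/-- **Lemma 6 exactly as printed (constant `1/150`), at the height `T`**, conditional on the
tree's named fact `BrentPlattTrudgian2021_lemma2` (`|R(T)| ≤ 1/(150T)`, `T ≥ 2π`), which is the
input the source cites ([BPT21, Lemma 2]). [cite: Simonic2022, Lemma 6] -/
theorem printed_bpt (hBPT : BrentPlattTrudgian2021_lemma2) {T c₀ C : ℝ} (hT : 2 * π ≤ T)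
    (hc₀ : 0 < c₀) (hpos : 2 * π * c₀ < T * Real.log (T / (2 * π)) * Real.log (Real.log T))
    (hS : ∀ t : ℝ, T ≤ t → |zetaArgS t| ≤ c₀ * Real.log t / Real.log (Real.log t))
    (hC : 4 * π * c₀ * (1 + (1 / 150) * Real.log (Real.log T) / (c₀ * T * Real.log T)) /
        (1 - Real.log (2 * π) / Real.log T - 2 * π * c₀ / (T * Real.log T * Real.log (Real.log T)))
        < C) :
    ∃ m : ℕ, T < zetaOrdinate m ∧ zetaOrdinate m ≤ T + C / Real.log (Real.log T) := by
  have hπ : 3 < π := Real.pi_gt_three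
  have he : Real.exp 1 < T := lt_of_lt_of_le (by have := Real.exp_one_lt_d9; linarith) hT
  refine printed (A := 1 / 150) (t₁ := 2 * π) (by positivity) (fun t ht ↦ ?_) hT he hc₀ hpos hS hC
  have h := hBPT t ht
  rwa [div_div]

end Simonic2022Lemma6

/-! ## Corollary 2 from Theorem 1 (i) -/

namespace Simonic2022Cor2

/-- `log 10 > 2.2794` (`log 10 = 3 log 2 + log(5/4)`, `log 2 > 0.6931471803`,
`log(5/4) ≥ 1 − 4/5`). [folklore] -/
private theorem log_ten_gt : (2.2794 : ℝ) < Real.log 10 := by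
  have h2 := Real.log_two_gt_d9
  have h54 : (1 : ℝ) / 5 ≤ Real.log (5 / 4) := by
    have h := Real.one_sub_inv_le_log_of_pos (x := (5 : ℝ) / 4) (by norm_num)
    have e : (1 : ℝ) - (5 / 4)⁻¹ = 1 / 5 := by norm_num
    rw [e] at h
    exact h
  have e : Real.log 10 = 3 * Real.log 2 + Real.log (5 / 4) := by
    rw [show (10 : ℝ) = 2 ^ 3 * (5 / 4) by norm_num, Real.log_mul (by norm_num) (by norm_num),
      Real.log_pow]
    norm_num
  rw [e]; linarith

/-- `log(2π) < 1.86` (`log 2 < 0.6931471808`, `log π ≤ π/e < 3.15/2.7182818283`). [folklore] -/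
private theorem log_two_pi_lt : Real.log (2 * π) < 1.86 := by
  have hπ : 0 < π := Real.pi_pos
  have hπ3 : π < 3.15 := Real.pi_lt_d2
  have he := Real.exp_one_gt_d9
  have h2 := Real.log_two_lt_d9
  have hlogπ : Real.log π ≤ π / Real.exp 1 := by
    have h := Real.log_le_sub_one_of_pos (x := π / Real.exp 1) (by positivity)
    rw [Real.log_div hπ.ne' (Real.exp_pos 1).ne', Real.log_exp] at h
    linarith
  have hq : π / Real.exp 1 < 1.16 := by
    rw [div_lt_iff₀ (Real.exp_pos 1)]; linarith
  rw [Real.log_mul (by norm_num) hπ.ne']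
  linarith

/-- For `T ≥ 10^2465`: `log T > 5618`. [folklore] -/
private theorem log_gt_of_ge {T : ℝ} (hT : (10 : ℝ) ^ 2465 ≤ T) : (5618 : ℝ) < Real.log T := by
  have h10 : Real.log ((10 : ℝ) ^ 2465) = 2465 * Real.log 10 := by
    rw [Real.log_pow]; push_cast; ring
  have h1 : Real.log ((10 : ℝ) ^ 2465) ≤ Real.log T := Real.log_le_log (by positivity) hT
  have h2 := log_ten_gt
  rw [h10] at h1
  linarith

/-- `16 ≤ 10^2465`. [folklore] -/
private theorem sixteen_le_pow : (16 : ℝ) ≤ (10 : ℝ) ^ 2465 :=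
  le_trans (by norm_num : (16 : ℝ) ≤ 10 ^ 2)
    (pow_le_pow_right₀ (by norm_num : (1 : ℝ) ≤ 10) (by norm_num : 2 ≤ 2465))

/-- `(log T)² ≤ 4T` for `T > 0` with `log T ≥ 0` (`e^{ℓ} = (e^{ℓ/2})² ≥ (1 + ℓ/2)²`). [folklore] -/
private theorem log_sq_le {T : ℝ} (hT : 0 < T) (hL : 0 ≤ Real.log T) :
    Real.log T ^ 2 ≤ 4 * T := by
  have h := Real.add_one_le_exp (Real.log T / 2)
  have h0 : 0 ≤ Real.log T / 2 + 1 := by linarith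
  have h2 : (Real.log T / 2 + 1) ^ 2 ≤ Real.exp (Real.log T / 2) ^ 2 :=
    pow_le_pow_left₀ h0 h 2
  have e : Real.exp (Real.log T / 2) ^ 2 = T := by
    rw [sq, ← Real.exp_add, add_halves, Real.exp_log hT]
  rw [e] at h2
  nlinarith

/-- The core inequality behind "Corollary 2 from Theorem 1 (i)", as pure real algebra in the
quantities `p = π ∈ (3, 3.141593)`, `l₂ = log 2π < 1.86`, `X ≥ 1`, `ℓ = log T > 5618`,
`1 ≤ m = log log T ≤ ℓ`, `u = 1/T ∈ (0, 4/ℓ²]`: with `c₀ = 0.759282 + 20.1911/X`,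
`ĉ = 9.55 + 253.82/X` one has `2c₀ℓ + 2(1.2/p)·m·u < ĉ((ℓ − l₂)/(2p) − c₀u/m)`, i.e. condition (⋆)
of Lemma 6 at `T` (`ĉ ≥ 4p·1.00035·c₀` coefficientwise absorbs the corrections).
[cite: Simonic2022, proof of Cor. 2] -/
theorem core_alg {p l₂ X ℓ m u : ℝ} (hp3 : 3 < p) (hp : p < 3.141593)
    (hl₂ : l₂ < 1.86) (hX1 : 1 ≤ X) (hℓ : 5618 < ℓ) (hm1 : 1 ≤ m) (hmℓ : m ≤ ℓ) (hu0 : 0 < u)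
    (hu : u ≤ 4 / ℓ ^ 2) :
    2 * (0.759282 + 20.1911 / X) * ℓ + 2 * (1.2 / p) * m * u <
      (9.55 + 253.82 / X) * ((ℓ - l₂) / (2 * p) - (0.759282 + 20.1911 / X) * u / m) := by
  have hp0 : 0 < p := by linarith
  have hX0 : 0 < X := by linarith
  have hℓ0 : 0 < ℓ := by linarith
  have hm0 : 0 < m := by linarith
  have hiX0 : 0 < 1 / X := by positivity
  have hiX1 : 1 / X ≤ 1 := by rw [div_le_one hX0]; exact hX1
  -- c₀ bounds
  have hc₀lo : (0.759282 : ℝ) ≤ 0.759282 + 20.1911 / X := by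
    have : (0 : ℝ) ≤ 20.1911 / X := by positivity
    linarith
  have hc₀hi : 0.759282 + 20.1911 / X ≤ (21 : ℝ) := by
    have : 20.1911 / X = 20.1911 * (1 / X) := by ring
    rw [this]; nlinarith
  have hc₀0 : (0 : ℝ) < 0.759282 + 20.1911 / X := by linarith
  -- ĉ ≥ 4p κ c₀, κ = 1.00035
  have hCge : 4 * p * 1.00035 * (0.759282 + 20.1911 / X) ≤ 9.55 + 253.82 / X := by
    have e1 : 4 * p * 1.00035 * (0.759282 + 20.1911 / X) =
        4 * p * 1.00035 * 0.759282 + (4 * p * 1.00035 * 20.1911) * (1 / X) := by ring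
    have e2 : (9.55 : ℝ) + 253.82 / X = 9.55 + 253.82 * (1 / X) := by ring
    rw [e1, e2]
    have ha : 4 * p * 1.00035 * 0.759282 ≤ (9.55 : ℝ) := by linarith
    have hb : 4 * p * 1.00035 * 20.1911 ≤ (253.82 : ℝ) := by linarith
    have hb' := mul_le_mul_of_nonneg_right hb hiX0.le
    linarith
  have hCnn : (0 : ℝ) ≤ 9.55 + 253.82 / X := by positivity
  -- u ≤ 4/5618² and m u ≤ ℓ u ≤ 4/ℓ ≤ 4/5618
  have hu' : u ≤ 4 / 5618 ^ 2 := by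
    refine hu.trans (div_le_div_of_nonneg_left (by norm_num) (by positivity) ?_)
    exact pow_le_pow_left₀ (by norm_num) hℓ.le 2
  have hmu : m * u ≤ 4 / 5618 := by
    have h1 : m * u ≤ ℓ * u := mul_le_mul_of_nonneg_right hmℓ hu0.le
    have h2 : ℓ * u ≤ ℓ * (4 / ℓ ^ 2) := mul_le_mul_of_nonneg_left hu hℓ0.le
    have h3 : ℓ * (4 / ℓ ^ 2) = 4 / ℓ := by field_simp
    have h4 : 4 / ℓ ≤ 4 / 5618 := div_le_div_of_nonneg_left (by norm_num) (by norm_num) hℓ.le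
    linarith
  have hmu0 : 0 ≤ m * u := by positivity
  -- the bracket: c₀u/m ≤ c₀u, and the bracket is ≥ 0
  have hbr : (ℓ - l₂) / (2 * p) - (0.759282 + 20.1911 / X) * u ≤
      (ℓ - l₂) / (2 * p) - (0.759282 + 20.1911 / X) * u / m := by
    have : (0.759282 + 20.1911 / X) * u / m ≤ (0.759282 + 20.1911 / X) * u := by
      rw [div_le_iff₀ hm0]
      exact le_mul_of_one_le_right (by positivity) hm1
    linarith
  have hcu : (0.759282 + 20.1911 / X) * u ≤ 21 * (4 / 5618 ^ 2) :=
    mul_le_mul hc₀hi hu' hu0.le (by norm_num)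
  have hbr0 : 0 ≤ (ℓ - l₂) / (2 * p) - (0.759282 + 20.1911 / X) * u := by
    have h1 : (893 : ℝ) ≤ (ℓ - l₂) / (2 * p) := by
      rw [le_div_iff₀ (by positivity)]; linarith
    linarith
  -- main chain
  have step1 : 4 * p * 1.00035 * (0.759282 + 20.1911 / X) *
      ((ℓ - l₂) / (2 * p) - (0.759282 + 20.1911 / X) * u) ≤
      (9.55 + 253.82 / X) * ((ℓ - l₂) / (2 * p) - (0.759282 + 20.1911 / X) * u / m) :=
    calc 4 * p * 1.00035 * (0.759282 + 20.1911 / X) *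
          ((ℓ - l₂) / (2 * p) - (0.759282 + 20.1911 / X) * u)
        ≤ (9.55 + 253.82 / X) * ((ℓ - l₂) / (2 * p) - (0.759282 + 20.1911 / X) * u) :=
          mul_le_mul_of_nonneg_right hCge hbr0
      _ ≤ (9.55 + 253.82 / X) * ((ℓ - l₂) / (2 * p) - (0.759282 + 20.1911 / X) * u / m) :=
          mul_le_mul_of_nonneg_left hbr hCnn
  have e1 : 4 * p * 1.00035 * (0.759282 + 20.1911 / X) *
      ((ℓ - l₂) / (2 * p) - (0.759282 + 20.1911 / X) * u) =
      2 * 1.00035 * ((0.759282 + 20.1911 / X) * ℓ) - 2 * 1.00035 * ((0.759282 + 20.1911 / X) * l₂)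
        - 4 * p * 1.00035 * ((0.759282 + 20.1911 / X) * ((0.759282 + 20.1911 / X) * u)) := by
    field_simp
    ring
  rw [e1] at step1
  -- the small terms
  have hq : (0.759282 + 20.1911 / X) * l₂ ≤ (0.759282 + 20.1911 / X) * 1.86 :=
    mul_le_mul_of_nonneg_left hl₂.le hc₀0.le
  have hpℓ : (0.759282 + 20.1911 / X) * 5618 < (0.759282 + 20.1911 / X) * ℓ :=
    mul_lt_mul_of_pos_left hℓ hc₀0
  have hw : (0.759282 + 20.1911 / X) * ((0.759282 + 20.1911 / X) * u) ≤
      (0.759282 + 20.1911 / X) * (21 * (4 / 5618 ^ 2)) :=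
    mul_le_mul_of_nonneg_left hcu hc₀0.le
  have hw' : 4 * p * 1.00035 * ((0.759282 + 20.1911 / X) * ((0.759282 + 20.1911 / X) * u)) ≤
      13 * ((0.759282 + 20.1911 / X) * (21 * (4 / 5618 ^ 2))) :=
    mul_le_mul (by linarith) hw (by positivity) (by norm_num)
  have hr : 2 * (1.2 / p) * m * u ≤ 2 * 0.4 * (4 / 5618) := by
    have hAp : 1.2 / p ≤ 0.4 := by rw [div_le_iff₀ hp0]; linarith
    have e : 2 * (1.2 / p) * m * u = 2 * ((1.2 / p) * (m * u)) := by ring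
    rw [e]
    have := mul_le_mul hAp hmu hmu0 (by norm_num)
    linarith
  have e2 : 2 * (0.759282 + 20.1911 / X) * ℓ = 2 * ((0.759282 + 20.1911 / X) * ℓ) := by ring
  rw [e2]
  linarith [hc₀lo]

/-- **Corollary 2 from Theorem 1 (i), at a height `T`**: under `Simonic2022_thm1_S` and RH, for
`T ≥ 10^2465` and any index `n` with `γ_n ≤ T`,
`γ_{n+1} ≤ T + 𝓜(9.55, 253.82, 0.285; T)/log log T`. [cite: Simonic2022, Cor. 2 (proof)] -/
theorem zetaOrdinate_succ_le (h : Simonic2022_thm1_S) (hRH : RiemannHypothesis) {T : ℝ}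
    (hT10 : (10 : ℝ) ^ 2465 ≤ T) {n : ℕ} (hn : zetaOrdinate n ≤ T) :
    zetaOrdinate (n + 1) ≤ T + simonicM 9.55 253.82 0.285 T / Real.log (Real.log T) := by
  have hℓ := log_gt_of_ge hT10
  have hT16 : (16 : ℝ) ≤ T := sixteen_le_pow.trans hT10
  -- uses of the threshold `10^2465` (then cleared: no tactic should try to evaluate it)
  have hS₀ : |zetaArgS T| ≤
      simonicM 0.759282 20.1911 0.285 T * Real.log T / Real.log (Real.log T) := h hRH T hT10
  have hthr : ∀ H : ℝ, 0 ≤ H → |zetaArgS (T + H)| ≤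
      simonicM 0.759282 20.1911 0.285 (T + H) * Real.log (T + H) / Real.log (Real.log (T + H)) :=
    fun H hH ↦ h hRH (T + H) (hT10.trans (le_add_of_nonneg_right hH))
  clear hT10
  have hT0 : 0 < T := by linarith
  have he : Real.exp 1 < T := lt_of_lt_of_le (by have := Real.exp_one_lt_d9; linarith) hT16
  have h2T : (2 : ℝ) ≤ T := by linarith
  have hL1 : 1 < Real.log T := by linarith
  have hLL : 0 < Real.log (Real.log T) := Real.log_pos hL1
  have hℓℓ1 : 1 ≤ Real.log (Real.log T) := by
    rw [← Real.log_exp 1]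
    exact Real.log_le_log (Real.exp_pos 1) (by have := Real.exp_one_lt_d9; linarith)
  have hℓℓ : Real.log (Real.log T) ≤ Real.log T := by
    have := Real.log_le_sub_one_of_pos (x := Real.log T) (by linarith)
    linarith
  have hsq := log_sq_le hT0 (by linarith)
  have hX1 : 1 ≤ Real.log T ^ (0.285 : ℝ) * Real.log (Real.log T) := by
    have h1 : (1 : ℝ) ≤ Real.log T ^ (0.285 : ℝ) := Real.one_le_rpow (by linarith) (by norm_num)
    nlinarith
  have hX0 : 0 < Real.log T ^ (0.285 : ℝ) * Real.log (Real.log T) := by linarith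
  have hc₀nn : 0 ≤ simonicM 0.759282 20.1911 0.285 T := by
    unfold simonicM; positivity
  have hCnn : 0 ≤ simonicM 9.55 253.82 0.285 T := by
    unfold simonicM; positivity
  -- the S-bound at `T + H`
  have hH : 0 ≤ simonicM 9.55 253.82 0.285 T / Real.log (Real.log T) := div_nonneg hCnn hLL.le
  have hS₁ : |zetaArgS (T + simonicM 9.55 253.82 0.285 T / Real.log (Real.log T))| ≤
      simonicM 0.759282 20.1911 0.285 T *
        Real.log (T + simonicM 9.55 253.82 0.285 T / Real.log (Real.log T)) /
        Real.log (Real.log (T + simonicM 9.55 253.82 0.285 T / Real.log (Real.log T))) := by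
    have h1 := hthr _ hH
    refine h1.trans ?_
    have hM := simonicM_le_of_le (a := 0.759282) (by norm_num : (0 : ℝ) ≤ 20.1911)
      (by norm_num : (0 : ℝ) ≤ 0.285) hT16
      (by linarith : T ≤ T + simonicM 9.55 253.82 0.285 T / Real.log (Real.log T))
    have hLH : 1 < Real.log (T + simonicM 9.55 253.82 0.285 T / Real.log (Real.log T)) :=
      lt_of_lt_of_le hL1 (Real.log_le_log hT0 (by linarith))
    have hLLH : 0 < Real.log (Real.log (T + simonicM 9.55 253.82 0.285 T /
      Real.log (Real.log T))) := Real.log_pos hLH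
    rw [mul_div_assoc, mul_div_assoc]
    exact mul_le_mul_of_nonneg_right hM (div_nonneg (by linarith) hLLH.le)
  -- condition (⋆) at `T`
  have hu : 1 / T ≤ 4 / Real.log T ^ 2 := by
    rw [div_le_div_iff₀ hT0 (by positivity)]; linarith
  have hcore := core_alg Real.pi_gt_three Real.pi_lt_d6 log_two_pi_lt
    hX1 hℓ hℓℓ1 hℓℓ (by positivity : (0 : ℝ) < 1 / T) hu
  have hcond : 2 * simonicM 0.759282 20.1911 0.285 T * Real.log T +
      2 * (1.2 / π) * Real.log (Real.log T) / T <
      simonicM 9.55 253.82 0.285 T * (Real.log (T / (2 * π)) / (2 * π) -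
        simonicM 0.759282 20.1911 0.285 T / (T * Real.log (Real.log T))) := by
    have e1 : Real.log (T / (2 * π)) = Real.log T - Real.log (2 * π) :=
      Real.log_div hT0.ne' (by positivity)
    have e2 : 2 * (1.2 / π) * Real.log (Real.log T) / T =
        2 * (1.2 / π) * Real.log (Real.log T) * (1 / T) := by ring
    have e3 : simonicM 0.759282 20.1911 0.285 T / (T * Real.log (Real.log T)) =
        simonicM 0.759282 20.1911 0.285 T * (1 / T) / Real.log (Real.log T) := by
      field_simp
    rw [e1, e2, e3]
    exact hcore
  exact Simonic2022Lemma6.zetaOrdinate_succ_le (A := 1.2 / π) (t₁ := 2) (n := n) (by norm_num)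
    (fun t ht ↦ abs_count_sub_countMain_sub_zetaArgS_le ht) h2T he hc₀nn hCnn hS₀ hS₁ hcond hn

end Simonic2022Cor2

/-! ## The "in particular" clause: `𝓜(9.55, 253.82, 0.285; γ) ≤ 12.05` for `γ ≥ 10^2465` -/

namespace Simonic2022Cor2Numerics

open Literature.Analysis.ValidatedNumerics.NumericsMP

/-- `0 < 2^80 = 1208925819614629174706176` in `ℕ` (the working scale of the kernel interval enclosures
below, written as a literal so that casts stay syntactically uniform). [folklore] -/
private theorem scale_pos : 0 < (1208925819614629174706176 : ℕ) := by norm_num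

/-- Kernel test: the enclosure `A ∋ 2^80 · log 10` (`MI.logNat2`, 70 terms) has
`23025761 · 2^80 ≤ A.lo · 10^7`. [folklore] -/
private theorem log_ten_check :
    (match MI.logNat2 1208925819614629174706176 70 10 with
      | some A => decide ((23025761 : ℤ) * 1208925819614629174706176 ≤ A.lo * 10 ^ 7)
      | none => false) = true := by
  decide +kernel

/-- `2.3025761 ≤ log 10` (kernel interval arithmetic). [folklore] -/
private theorem log_ten_ge : (2.3025761 : ℝ) ≤ Real.log 10 := by
  have h := log_ten_check
  split at h
  · rename_i A hA
    rw [decide_eq_true_eq] at h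
    have hS : (0 : ℝ) < 1208925819614629174706176 := by norm_num
    have hm := (MI.mem_logNat2 scale_pos hA).1
    simp only [Nat.cast_ofNat] at hm
    have h' : (23025761 : ℝ) * 1208925819614629174706176 ≤ (A.lo : ℝ) * 10 ^ 7 := by exact_mod_cast h
    have h3 : (23025761 : ℝ) * 1208925819614629174706176 ≤ Real.log 10 * 10 ^ 7 * 1208925819614629174706176 := by
      linarith
    have h4 := le_of_mul_le_mul_right h3 hS
    linarith
  · simp at h

/-- Kernel test: enclosures `A ∋ 2^80 log 567585`, `B ∋ 2^80 log 100` with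
`864397 · 2^80 ≤ (A.lo − B.hi) · 10^5`. [folklore] -/
private theorem log_aux_check :
    (match MI.logNat2 1208925819614629174706176 70 567585, MI.logNat2 1208925819614629174706176 70 100 with
      | some A, some B => decide ((864397 : ℤ) * 1208925819614629174706176 ≤ (A.lo - B.hi) * 10 ^ 5)
      | _, _ => false) = true := by
  decide +kernel

/-- `8.64397 ≤ log 5675.85` (`= log 567585 − log 100`; kernel interval arithmetic). [folklore] -/
private theorem log_aux_ge : (8.64397 : ℝ) ≤ Real.log 5675.85 := by
  have h := log_aux_check
  split at h
  · rename_i A B hA hB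
    rw [decide_eq_true_eq] at h
    have hS : (0 : ℝ) < 1208925819614629174706176 := by norm_num
    have hmA := (MI.mem_logNat2 scale_pos hA).1
    have hmB := (MI.mem_logNat2 scale_pos hB).2
    simp only [Nat.cast_ofNat] at hmA hmB
    have h' : (864397 : ℝ) * 1208925819614629174706176 ≤ ((A.lo : ℝ) - B.hi) * 10 ^ 5 := by exact_mod_cast h
    have e : Real.log 5675.85 = Real.log 567585 - Real.log 100 := by
      rw [← Real.log_div (by norm_num) (by norm_num)]; norm_num
    rw [e]
    have h3 : (864397 : ℝ) * 1208925819614629174706176 ≤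
        (Real.log 567585 - Real.log 100) * 10 ^ 5 * 1208925819614629174706176 := by
      linarith
    have h4 := le_of_mul_le_mul_right h3 hS
    linarith
  · simp at h

/-- Kernel test: the enclosure `Y ∋ 2^80 e^{2.46353}` (`MI.exp`, 40 terms, 6 halvings) has
`117457 · 2^80 ≤ Y.lo · 10^4`. [folklore] -/
private theorem exp_aux_check :
    (match MI.exp 1208925819614629174706176 40 6 (MI.ofFrac 1208925819614629174706176 246353 100000) with
      | some Y => decide ((117457 : ℤ) * 1208925819614629174706176 ≤ Y.lo * 10 ^ 4)
      | none => false) = true := by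
  decide +kernel

/-- `11.7457 ≤ e^{2.46353}` (kernel interval arithmetic). [folklore] -/
private theorem exp_aux_ge : (11.7457 : ℝ) ≤ Real.exp 2.46353 := by
  have h := exp_aux_check
  split at h
  · rename_i Y hY
    rw [decide_eq_true_eq] at h
    have hS : (0 : ℝ) < 1208925819614629174706176 := by norm_num
    have hx : MI.mem 1208925819614629174706176 ((246353 : ℤ) / (100000 : ℕ) : ℝ)
        (MI.ofFrac 1208925819614629174706176 246353 100000) :=
      MI.mem_ofFrac 1208925819614629174706176 246353 (by norm_num)
    have hm := (MI.mem_exp scale_pos hY hx).1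
    have e : (((246353 : ℤ) : ℝ) / ((100000 : ℕ) : ℝ)) = 2.46353 := by norm_num
    rw [e] at hm
    simp only [Nat.cast_ofNat] at hm
    have h' : (117457 : ℝ) * 1208925819614629174706176 ≤ (Y.lo : ℝ) * 10 ^ 4 := by exact_mod_cast h
    have h3 : (117457 : ℝ) * 1208925819614629174706176 ≤ Real.exp 2.46353 * 10 ^ 4 * 1208925819614629174706176 := by
      linarith
    have h4 := le_of_mul_le_mul_right h3 hS
    linarith
  · simp at h

/-- `(log γ)^{0.285} · log log γ ≥ 101.528` once `log γ ≥ 5675.85`. [folklore] -/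
private theorem rpow_mul_log_ge {ℓ : ℝ} (hℓ : 5675.85 ≤ ℓ) :
    (101.528 : ℝ) ≤ ℓ ^ (0.285 : ℝ) * Real.log ℓ := by
  have hℓ0 : 0 < ℓ := by linarith
  have hlog : 8.64397 ≤ Real.log ℓ :=
    log_aux_ge.trans (Real.log_le_log (by norm_num) hℓ)
  have hpow : 11.7457 ≤ ℓ ^ (0.285 : ℝ) := by
    rw [Real.rpow_def_of_pos hℓ0]
    exact exp_aux_ge.trans (Real.exp_le_exp.2 (by nlinarith))
  have := mul_le_mul hpow hlog (by norm_num) (by linarith)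
  linarith

/-- For `γ ≥ 10^2465`: `log γ ≥ 5675.85` (`log 10 ≥ 2.3025761`). [folklore] -/
private theorem log_ge {T : ℝ} (hT : (10 : ℝ) ^ 2465 ≤ T) : (5675.85 : ℝ) ≤ Real.log T := by
  have h10 : Real.log ((10 : ℝ) ^ 2465) = 2465 * Real.log 10 := by
    rw [Real.log_pow]; push_cast; ring
  have h1 : Real.log ((10 : ℝ) ^ 2465) ≤ Real.log T := Real.log_le_log (by positivity) hT
  have h2 := log_ten_ge
  rw [h10] at h1
  linarith

/-- **`𝓜(9.55, 253.82, 0.285; γ) ≤ 12.05` for `γ ≥ 10^2465`** (the source: "In particular,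
`γ' − γ ≤ 12.05/log log γ`"; numerically `𝓜(…; 10^2465) = 12.0498…`).
[cite: Simonic2022, Cor. 2 (in particular)] -/
theorem simonicM_le {T : ℝ} (hT : (10 : ℝ) ^ 2465 ≤ T) :
    simonicM 9.55 253.82 0.285 T ≤ 12.05 := by
  have hℓ := log_ge hT
  clear hT
  have hX := rpow_mul_log_ge hℓ
  have hX0 : (0 : ℝ) < Real.log T ^ (0.285 : ℝ) * Real.log (Real.log T) := by linarith
  unfold simonicM
  have : 253.82 / (Real.log T ^ (0.285 : ℝ) * Real.log (Real.log T)) ≤ 253.82 / 101.528 :=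
    div_le_div_of_nonneg_left (by norm_num) (by norm_num) hX
  have h2 : (253.82 : ℝ) / 101.528 = 2.5 := by norm_num
  linarith

end Simonic2022Cor2Numerics

namespace Simonic2022_cor2

/-- Corollary 2 ⟹ its "in particular" clause: `Simonic2022_cor2 → Simonic2022_cor2_simple`
(`𝓜(9.55, 253.82, 0.285; γ) ≤ 12.05` for `γ ≥ 10^2465`, `Simonic2022Cor2Numerics.simonicM_le`).
[cite: Simonic2022, Cor. 2 (in particular)] -/
theorem simple (h : Simonic2022_cor2) : Simonic2022_cor2_simple := by
  intro hRH n hn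
  have h1 := h hRH n hn
  have hM := Simonic2022Cor2Numerics.simonicM_le hn
  have hℓ := Simonic2022Cor2Numerics.log_ge hn
  clear hn
  have hLL : 0 ≤ Real.log (Real.log (zetaOrdinate n)) := Real.log_nonneg (by linarith)
  exact h1.trans (div_le_div_of_nonneg_right hM hLL)

end Simonic2022_cor2

namespace Simonic2022_thm1_S

/-- **Corollary 2 from Theorem 1 (i)** (Simonič 2022), in the kernel: the RH-conditional gap bound
`γ' − γ ≤ 𝓜(9.55, 253.82, 0.285; γ)/log log γ` for consecutive ordinates `γ' ≥ γ ≥ 10^2465`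
FOLLOWS from the RH-conditional `S`-bound of Theorem 1 (i) by Lemma 6 — following the printed
proof (apply the gap lemma at `T = γ` with `c₀ = 𝓜(0.759282, 20.1911, 0.285; γ)`, a valid
`S`-bound at `γ` and at `γ + H` since `𝓜(·; t)` is non-increasing), with the tree's proved
remainder `|N − L − S| ≤ (1.2/π)/t` in place of [BPT21, Lemma 2]. So the named fact
`Simonic2022_cor2` is implied by `Simonic2022_thm1_S`. [cite: Simonic2022, Cor. 2 (proof)] -/
theorem cor2 (h : Simonic2022_thm1_S) : Simonic2022_cor2 := by
  intro hRH n hn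
  exact sub_le_iff_le_add'.2 (Simonic2022Cor2.zetaOrdinate_succ_le h hRH hn le_rfl)

/-- **Corollary 2, "in particular" clause, from Theorem 1 (i)**:
`Simonic2022_thm1_S → Simonic2022_cor2_simple` (`γ' − γ ≤ 12.05/log log γ` for consecutive
ordinates `γ' ≥ γ ≥ 10^2465`, under RH). [cite: Simonic2022, Cor. 2 (in particular)] -/
theorem cor2_simple (h : Simonic2022_thm1_S) : Simonic2022_cor2_simple :=
  (cor2 h).simple

end Simonic2022_thm1_S

/-- `Simonic2022_cor2` holds as soon as `Simonic2022_thm1_S` does (restatement of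
`Simonic2022_thm1_S.cor2` at top level, for `lean search`). [cite: Simonic2022, Cor. 2] -/
theorem Simonic2022_cor2_of_thm1_S (h : Simonic2022_thm1_S) : Simonic2022_cor2 :=
  Simonic2022_thm1_S.cor2 h

/-- `Simonic2022_cor2_simple` holds as soon as `Simonic2022_thm1_S` does.
[cite: Simonic2022, Cor. 2 (in particular)] -/
theorem Simonic2022_cor2_simple_of_thm1_S (h : Simonic2022_thm1_S) : Simonic2022_cor2_simple :=
  Simonic2022_thm1_S.cor2_simple h

end Literature.NumberTheory.LFunctions

end
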